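import Mathlib
import Literature.Probability.LatticeModels.GKSInequalities
import Literature.Probability.LatticeModels.IsingInverseMCertificate
import Literature.Probability.LatticeModels.IsingInverseMCertificateSound
import Literature.Probability.LatticeModels.IsingInverseMCertificateSym
import Literature.Probability.LatticeModels.IsingInverseMCertificateAuto
import HarnessLib

/-!
# Row sums of the inverse: certificates for `0 ≤ ∑_w (Σ⁻¹)_{xw}` (`checkSymRow`, `checkAutoRow`)

The symmetry-reduced certificates of `IsingInverseMCertificateSym.lean` / `…Auto.lean` prove that the
inverse of the spin second-moment matrix `Σ` of a uniform-coupling zero-field Ising ferromagnet on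
`(Fin n, E)` is a Z-matrix.  On vertex-transitive graphs (tori in particular) one expects more:
`Σ⁻¹` has NONNEGATIVE ROW SUMS (`Σ⁻¹ 𝟙 = 𝟙/χ ≥ 0`, i.e. `Σ` is the Green kernel of a killed
reversible walk — the "potential" form of the inverse-M property used by the `PrecisionLaplacian`
route, items `InverseMCriticalKernel` / `DirectCorrelationStableTail`).  This file adds the check
`rowSumOK` (the row sums of the certificate matrix `B` over the checked rows have nonnegative
coefficients) and proves: `checkSymCore ∧ rowSumOK` (with true rows) gives, for every `K ≥ 0` and
every site `x`, `0 ≤ ∑_w (Σ⁻¹)_{xw}` (`rowsum_nonneg_of_checkSymCore`); wrappers `checkSymRow`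
(explicit data, kernel) and `checkAutoRow` (self-computed, `native_decide`).  The proof re-derives
the identity `M(v)·B(v) = d(v)·1` on all rows from the core checks (as in the soundness proof of
`checkSymCore`), whence `Σ⁻¹ = c·B(v)` with `c > 0`, and transports the row-sum sign along the
automorphism generators (row sums of `B` are constant on orbits). [cite: FriedliVelenik2017, §3.8.1]
-/

namespace Literature.Probability.LatticeModels

namespace IsingPolynomial

open Finset Matrix

/-! ### The checks -/

/-- The row sums `∑_q B_{pq}` over the checked rows have nonnegative coefficients. [folklore] -/
def rowSumOK (n : ℕ) (Bcls : List (List ℤ)) (Bidx : List (List ℕ)) (rows : List ℕ) : Bool :=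
  rows.all fun p => lNonneg (lsum ((List.range n).map fun q => getB Bcls Bidx p q))

/-- `checkSym` plus nonnegative row sums. [folklore] -/
def checkSymRow (n : ℕ) (E : List (ℕ × ℕ)) (Mtab : List (List (List ℤ))) (Bcls : List (List ℤ))
    (Bidx : List (List ℕ)) (d : List ℤ) (rows : List ℕ) (gens : List (List ℕ × List ℕ)) : Bool :=
  checkSym n E Mtab Bcls Bidx d rows gens && rowSumOK n Bcls Bidx rows

/-- `checkAuto` plus nonnegative row sums (self-computed certificate). [folklore] -/
def checkAutoRow (n : ℕ) (E : List (ℕ × ℕ)) (rows : List ℕ) (gens : List (List ℕ × List ℕ))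
    (coset : List (ℕ × List ℕ)) : Bool :=
  let Mtab := rowTable n E rows
  let c := autoCert n E rows coset Mtab
  checkSymCore n E Mtab c.1 c.2.1 c.2.2 rows gens && rowSumOK n c.1 c.2.1 rows

/-! ### Soundness -/

section Soundness

variable {n : ℕ} {E : List (ℕ × ℕ)}

/-- From a verified identity `M(v)·B = d·1` (`d > 0`): the inverse of the second-moment matrix is a
POSITIVE multiple of `B`. [folklore] -/
theorem inv_eq_smul_of_mul_eq (hE : edgesOK n E = true) (K : ℝ) (Bv : Matrix (Fin n) (Fin n) ℝ)
    (dv : ℝ) (hd : 0 < dv)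
    (hMB : (Matrix.of fun p q : Fin n => leval (entry n E p q) (Real.exp (2 * K) - 1)) * Bv =
      dv • (1 : Matrix (Fin n) (Fin n) ℝ)) :
    ∃ c : ℝ, 0 < c ∧ (Matrix.of fun p q : Fin n => gksExpect Finset.univ (fun _ : Fin E.length => K)
      (edgeSet n E) (fun ω => spinAt p ω * spinAt q ω))⁻¹ = c • Bv := by
  set v : ℝ := Real.exp (2 * K) - 1 with hv_def
  set c0 : ℝ := Real.exp (-K) ^ E.length with hc_def
  have hc0 : 0 < c0 := pow_pos (Real.exp_pos _) _
  set Z : ℝ := gksSum Finset.univ (fun _ : Fin E.length => K) (edgeSet n E) (fun _ => 1) with hZ_def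
  have hZ : 0 < Z := gksSum_one_pos _ _ _
  set Mv : Matrix (Fin n) (Fin n) ℝ := Matrix.of fun p q : Fin n => leval (entry n E p q) v with hMv
  have hG : (Matrix.of fun p q : Fin n => gksExpect Finset.univ (fun _ : Fin E.length => K)
      (edgeSet n E) (fun ω => spinAt p ω * spinAt q ω)) = (Z⁻¹ * c0) • Mv := by
    ext p q
    simp only [Matrix.of_apply, Matrix.smul_apply, smul_eq_mul, hMv, gksExpect]
    rw [gksSum_pair_eq hE K p q, ← hZ_def, div_eq_inv_mul]; ring
  have hinv : ((Z⁻¹ * c0) • Mv)⁻¹ = ((Z⁻¹ * c0)⁻¹ * dv⁻¹) • Bv := by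
    apply Matrix.inv_eq_right_inv
    rw [Matrix.smul_mul, Matrix.mul_smul, hMB, smul_smul, smul_smul]
    rw [show Z⁻¹ * c0 * ((Z⁻¹ * c0)⁻¹ * dv⁻¹) * dv = 1 by field_simp]
    exact one_smul _ _
  exact ⟨(Z⁻¹ * c0)⁻¹ * dv⁻¹, by positivity, by rw [hG, hinv]⟩

/-- **The identity on all rows** from the core checks: if `checkSymCore` accepts and the rows `rows`
of `Mtab` are true, then `M(v)·B(v) = d(v)·1` for the true Edwards–Sokal matrix. [folklore] -/
theorem mul_eq_of_checkSymCore {Mtab : List (List (List ℤ))} {Bcls : List (List ℤ)}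
    {Bidx : List (List ℕ)} {d : List ℤ} {rows : List ℕ} {gens : List (List ℕ × List ℕ)}
    (h : checkSymCore n E Mtab Bcls Bidx d rows gens = true)
    (hM : ∀ p ∈ rows, p < n → ∀ q < n, ∀ v : ℝ, leval (getPoly Mtab p q) v = leval (entry n E p q) v)
    (v : ℝ) :
    (Matrix.of fun p q : Fin n => leval (entry n E p q) v) *
        (Matrix.of fun p q : Fin n => leval (getB Bcls Bidx p q) v) =
      leval d v • (1 : Matrix (Fin n) (Fin n) ℝ) := by
  simp only [checkSymCore, Bool.and_eq_true] at h
  obtain ⟨⟨⟨⟨⟨⟨hE, hrows⟩, hP⟩, _⟩, _⟩, hgens⟩, hcov⟩ := h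
  set Mv : Matrix (Fin n) (Fin n) ℝ := Matrix.of fun p q : Fin n => leval (entry n E p q) v with hMv
  set Bv : Matrix (Fin n) (Fin n) ℝ := Matrix.of fun p q : Fin n => leval (getB Bcls Bidx p q) v
    with hBv
  let Good : ℕ → Prop := fun p => ∀ (hp : p < n) (q : Fin n),
    (Mv * Bv) ⟨p, hp⟩ q = if p = (q : ℕ) then leval d v else 0
  have hseed : ∀ p ∈ rows, Good p := by
    intro p hpr hp q
    have hPp := List.all_eq_true.1 hP p hpr
    have hMp := hM p hpr hp
    have key := leval_eq_of_lEq v (all_range hPp q.2)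
    rw [prodEntry, leval_lsum, List.map_map] at key
    have hsum : ∑ r : Fin n, leval (entry n E p r) v * leval (getB Bcls Bidx r q) v =
        leval (if p = (q : ℕ) then d else []) v := by
      rw [← key, Fin.sum_univ_eq_sum_range
        (fun r => leval (entry n E p r) v * leval (getB Bcls Bidx r q) v) n, ← list_sum_range_eq]
      congr 1
      refine List.map_congr_left fun r hr => ?_
      simp only [Function.comp, leval_lmul]
      rw [hMp r (List.mem_range.1 hr) v]
    simp only [hMv, hBv, Matrix.mul_apply, Matrix.of_apply]
    rw [hsum]
    split_ifs <;> simp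
  have hstep : ∀ g ∈ gens, ∀ p < n, Good p → Good (permAt g.1 p) := by
    intro g hg p hp hgood hπp q
    have hg' := List.all_eq_true.1 hgens g hg
    simp only [Bool.and_eq_true] at hg'
    obtain ⟨⟨hpi, htau⟩, hBinv⟩ := hg'
    set π := permEquiv g.1 hpi with hπ
    have hπp_eq : (⟨permAt g.1 p, hπp⟩ : Fin n) = π ⟨p, hp⟩ := Fin.ext rfl
    have hBi : ∀ r s : Fin n, Bv (π r) (π s) = Bv r s := by
      intro r s
      simp only [hBv, Matrix.of_apply]
      exact leval_eq_of_lEq v (all_range (all_range hBinv r.2) s.2)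
    have hMi : ∀ r s : Fin n, Mv (π r) (π s) = Mv r s := by
      intro r s
      simp only [hMv, Matrix.of_apply]
      exact entry_perm_invariant hE hpi htau v r s
    rw [hπp_eq, Matrix.mul_apply, ← Equiv.sum_comp π]
    have hq : q = π (π.symm q) := (Equiv.apply_symm_apply π q).symm
    conv_lhs => rw [hq]
    simp_rw [hMi, hBi]
    have := hgood hp (π.symm q)
    rw [Matrix.mul_apply] at this
    rw [this]
    have hiff : p = ((π.symm q : Fin n) : ℕ) ↔ permAt g.1 p = (q : ℕ) := by
      constructor
      · intro h1
        have h2 : (⟨p, hp⟩ : Fin n) = π.symm q := Fin.ext h1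
        have h3 : π ⟨p, hp⟩ = q := by rw [h2, Equiv.apply_symm_apply]
        exact congrArg Fin.val h3
      · intro h1
        have h2 : π ⟨p, hp⟩ = q := Fin.ext h1
        have h3 : (⟨p, hp⟩ : Fin n) = π.symm q := by rw [← h2, Equiv.symm_apply_apply]
        exact congrArg Fin.val h3
    by_cases hc : p = ((π.symm q : Fin n) : ℕ)
    · rw [if_pos hc, if_pos (hiff.1 hc)]
    · rw [if_neg hc, if_neg (mt hiff.2 hc)]
  have hall : ∀ p < n, Good p := by
    intro p hp
    refine coverIter_induction Good hstep n _ (fun q hq hq0 => ?_) p hp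
      (List.all_eq_true.1 (by simpa [coverAll] using hcov) p (List.mem_range.2 hp))
    rw [List.getD_eq_getElem _ _ (by simpa using hq)] at hq0
    simp only [List.getElem_map, List.getElem_range, List.any_eq_true, beq_iff_eq] at hq0
    obtain ⟨r, hr, rfl⟩ := hq0
    exact hseed r hr
  ext p q
  rw [hall p p.2 p.2 q]
  simp only [Matrix.smul_apply, Matrix.one_apply, smul_eq_mul, mul_ite, mul_one, mul_zero, Fin.ext_iff]

/-- Row sums of the certificate matrix are constant along the generators. [folklore] -/
theorem rowsum_perm {Bcls : List (List ℤ)} {Bidx : List (List ℕ)} {pi : List ℕ}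
    (hpi : permOK n pi = true) (hBinv : bInvariantOK n Bcls Bidx pi = true) (v : ℝ) (p : Fin n) :
    ∑ w : Fin n, leval (getB Bcls Bidx (permEquiv pi hpi p) w) v =
      ∑ w : Fin n, (leval (getB Bcls Bidx p w) v : ℝ) := by
  rw [← Equiv.sum_comp (permEquiv pi hpi)]
  refine Finset.sum_congr rfl fun w _ => ?_
  exact leval_eq_of_lEq v (all_range (all_range hBinv p.2) w.2)

/-- **Nonnegative row sums of `Σ⁻¹`** from `checkSymCore` with true rows and `rowSumOK`. [folklore] -/
theorem rowsum_nonneg_of_checkSymCore {Mtab : List (List (List ℤ))} {Bcls : List (List ℤ)}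
    {Bidx : List (List ℕ)} {d : List ℤ} {rows : List ℕ} {gens : List (List ℕ × List ℕ)}
    (h : checkSymCore n E Mtab Bcls Bidx d rows gens = true)
    (hM : ∀ p ∈ rows, p < n → ∀ q < n, ∀ v : ℝ, leval (getPoly Mtab p q) v = leval (entry n E p q) v)
    (hR : rowSumOK n Bcls Bidx rows = true) (K : ℝ) (hK : 0 ≤ K) (x : Fin n) :
    0 ≤ ∑ w : Fin n, (Matrix.of fun p q : Fin n => gksExpect Finset.univ (fun _ : Fin E.length => K)
        (edgeSet n E) (fun ω => spinAt p ω * spinAt q ω))⁻¹ x w := by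
  have hMB := mul_eq_of_checkSymCore h hM (Real.exp (2 * K) - 1)
  have h' := h
  simp only [checkSymCore, Bool.and_eq_true] at h'
  obtain ⟨⟨⟨⟨⟨⟨hE, -⟩, -⟩, ⟨hd, hd0⟩⟩, -⟩, hgens⟩, hcov⟩ := h'
  set v : ℝ := Real.exp (2 * K) - 1 with hv_def
  have hv : 0 ≤ v := sub_nonneg.2 (Real.one_le_exp (by linarith))
  obtain ⟨c, hc, hinv⟩ := inv_eq_smul_of_mul_eq hE K _ _ (leval_pos hd hd0 hv) hMB
  rw [hinv]
  simp only [Matrix.smul_apply, Matrix.of_apply, smul_eq_mul, ← Finset.mul_sum]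
  refine mul_nonneg hc.le ?_
  -- row sums of `B(v)` are ≥ 0 on every row: seed rows by `rowSumOK`, transport along generators
  let Good : ℕ → Prop := fun p => ∀ hp : p < n,
    0 ≤ ∑ w : Fin n, (leval (getB Bcls Bidx (⟨p, hp⟩ : Fin n) w) v : ℝ)
  have hseed : ∀ p ∈ rows, Good p := by
    intro p hpr hp
    have hRp := leval_nonneg (List.all_eq_true.1 hR p hpr) hv
    rw [leval_lsum, List.map_map, show ((List.range n).map
        ((fun p => leval p v) ∘ fun q => getB Bcls Bidx p q)) =
        (List.range n).map (fun q => (leval (getB Bcls Bidx p q) v : ℝ)) from rfl,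
      list_sum_range_eq, ← Fin.sum_univ_eq_sum_range (fun q => (leval (getB Bcls Bidx p q) v : ℝ))]
      at hRp
    exact hRp
  have hstep : ∀ g ∈ gens, ∀ p < n, Good p → Good (permAt g.1 p) := by
    intro g hg p hp hgood hπp
    have hg' := List.all_eq_true.1 hgens g hg
    simp only [Bool.and_eq_true] at hg'
    obtain ⟨⟨hpi, -⟩, hBinv⟩ := hg'
    have hπp_eq : (⟨permAt g.1 p, hπp⟩ : Fin n) = permEquiv g.1 hpi ⟨p, hp⟩ := Fin.ext rfl
    rw [hπp_eq, rowsum_perm hpi hBinv v ⟨p, hp⟩]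
    exact hgood hp
  have hall : ∀ p < n, Good p := by
    intro p hp
    refine coverIter_induction Good hstep n _ (fun q hq hq0 => ?_) p hp
      (List.all_eq_true.1 (by simpa [coverAll] using hcov) p (List.mem_range.2 hp))
    rw [List.getD_eq_getElem _ _ (by simpa using hq)] at hq0
    simp only [List.getElem_map, List.getElem_range, List.any_eq_true, beq_iff_eq] at hq0
    obtain ⟨r, hr, rfl⟩ := hq0
    exact hseed r hr
  exact hall x x.2 x.2

/-- **Soundness of `checkSymRow`**: nonnegative row sums of `Σ⁻¹` (explicit certificates). [folklore] -/
theorem rowsum_nonneg_of_checkSymRow {Mtab : List (List (List ℤ))} {Bcls : List (List ℤ)}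
    {Bidx : List (List ℕ)} {d : List ℤ} {rows : List ℕ} {gens : List (List ℕ × List ℕ)}
    (h : checkSymRow n E Mtab Bcls Bidx d rows gens = true) (K : ℝ) (hK : 0 ≤ K) (x : Fin n) :
    0 ≤ ∑ w : Fin n, (Matrix.of fun p q : Fin n => gksExpect Finset.univ (fun _ : Fin E.length => K)
        (edgeSet n E) (fun ω => spinAt p ω * spinAt q ω))⁻¹ x w := by
  simp only [checkSymRow, checkSym, Bool.and_eq_true] at h
  obtain ⟨⟨hM, hcore⟩, hR⟩ := h
  refine rowsum_nonneg_of_checkSymCore hcore (fun p hp _ q hq v => ?_) hR K hK x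
  rw [← entryF_eq]
  exact leval_eq_of_lEq v (all_range (List.all_eq_true.1 hM p hp) hq)

/-- `checkSymRow` implies `checkSym` (so the Z-matrix conclusion is available too). [folklore] -/
theorem checkSym_of_checkSymRow {Mtab : List (List (List ℤ))} {Bcls : List (List ℤ)}
    {Bidx : List (List ℕ)} {d : List ℤ} {rows : List ℕ} {gens : List (List ℕ × List ℕ)}
    (h : checkSymRow n E Mtab Bcls Bidx d rows gens = true) :
    checkSym n E Mtab Bcls Bidx d rows gens = true := by
  simp only [checkSymRow, Bool.and_eq_true] at h
  exact h.1

/-- **Soundness of `checkAutoRow`**: nonnegative row sums of `Σ⁻¹` (self-computed). [folklore] -/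
theorem rowsum_nonneg_of_checkAutoRow {rows : List ℕ} {gens : List (List ℕ × List ℕ)}
    {coset : List (ℕ × List ℕ)} (h : checkAutoRow n E rows gens coset = true) (K : ℝ) (hK : 0 ≤ K)
    (x : Fin n) :
    0 ≤ ∑ w : Fin n, (Matrix.of fun p q : Fin n => gksExpect Finset.univ (fun _ : Fin E.length => K)
        (edgeSet n E) (fun ω => spinAt p ω * spinAt q ω))⁻¹ x w := by
  have h' : (checkSymCore n E (rowTable n E rows) (autoCert n E rows coset (rowTable n E rows)).1
      (autoCert n E rows coset (rowTable n E rows)).2.1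
      (autoCert n E rows coset (rowTable n E rows)).2.2 rows gens &&
      rowSumOK n (autoCert n E rows coset (rowTable n E rows)).1
        (autoCert n E rows coset (rowTable n E rows)).2.1 rows) = true := h
  simp only [Bool.and_eq_true] at h'
  exact rowsum_nonneg_of_checkSymCore h'.1
    (fun _ hp hpn _ hq v => leval_getPoly_rowTable hp hpn hq v) h'.2 K hK x

/-- `checkAutoRow` implies `checkAuto` (so the Z-matrix conclusion is available too). [folklore] -/
theorem checkAuto_of_checkAutoRow {rows : List ℕ} {gens : List (List ℕ × List ℕ)}
    {coset : List (ℕ × List ℕ)} (h : checkAutoRow n E rows gens coset = true) :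
    checkAuto n E rows gens coset = true := by
  have h' : (checkSymCore n E (rowTable n E rows) (autoCert n E rows coset (rowTable n E rows)).1
      (autoCert n E rows coset (rowTable n E rows)).2.1
      (autoCert n E rows coset (rowTable n E rows)).2.2 rows gens &&
      rowSumOK n (autoCert n E rows coset (rowTable n E rows)).1
        (autoCert n E rows coset (rowTable n E rows)).2.1 rows) = true := h
  simp only [Bool.and_eq_true] at h'
  exact h'.1

end Soundness

end IsingPolynomial

end Literature.Probability.LatticeModels
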